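import Literature.Computability.AlgebraicComplexity.ValiantClassesProofs
import HarnessLib

/-!
# Closure properties of quasi-polynomially bounded functions

`IsQPBounded t := ∃ c, ∀ n, t n ≤ 2 ^ ((log₂ n + c) ^ c)` (`ValiantClasses.lean`, the single-constant
form of Bürgisser 2000, Def. 2.26 / Bürgisser–Clausen–Shokrollahi 1997, Def. (21.31)). This file
proves the bookkeeping behind "qp ∘ poly = qp, qp + qp = qp, qp · qp = qp" used whenever a
quasi-polynomial bound is threaded through a polynomial-size construction (e.g. Bürgisser 2000,
§2.5; the quasi-polynomial transfer arguments of Bürgisser 2009, §2):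

* exponent bookkeeping `1 ≤ (L + c)^c`, `c ≤ (L + c)^c`, monotonicity in `c`,
  `3 (L + c)^c ≤ (L + c + 2)^(c + 2)` (`one_le_qexp`, `le_qexp`, `qexp_mono`, `three_mul_qexp_le`);
* `IsQPBounded` is closed under constants, domination, sums, products and fixed powers
  (`IsQPBounded.const/mono/add/mul/pow`);
* along a p-bounded `t`, `n ↦ 2 ^ ((log₂ (t n) + c) ^ c)` is qp-bounded (`two_pow_qexp_log`).

References: P. Bürgisser, *Completeness and Reduction in Algebraic Complexity Theory*, Springer
2000, Def. 2.26, §2.5; P. Bürgisser, M. Clausen, M. A. Shokrollahi, *Algebraic Complexity Theory*,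
Springer 1997, Def. (21.31).
-/

namespace Literature.Computability.AlgebraicComplexity

namespace IsQPBounded

/-! ### Exponent bookkeeping -/

/-- `1 ≤ (L + c)^c`. [folklore] -/
theorem one_le_qexp (L c : ℕ) : 1 ≤ (L + c) ^ c := by
  rcases Nat.eq_zero_or_pos c with rfl | hc
  · simp
  · exact Nat.one_le_pow _ _ (by omega)

/-- `c ≤ (L + c)^c`. [folklore] -/
theorem le_qexp (L c : ℕ) : c ≤ (L + c) ^ c := by
  rcases Nat.eq_zero_or_pos c with rfl | hc
  · simp
  · calc c ≤ L + c := Nat.le_add_left c L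
      _ = (L + c) ^ 1 := (pow_one _).symm
      _ ≤ (L + c) ^ c := Nat.pow_le_pow_right (by omega) hc

/-- The quasi-polynomial exponent `(L + c)^c` is monotone in `c`. [folklore] -/
theorem qexp_mono (L : ℕ) {a c : ℕ} (h : a ≤ c) : (L + a) ^ a ≤ (L + c) ^ c := by
  rcases Nat.eq_zero_or_pos c with rfl | hc
  · rw [Nat.le_zero.mp h]
  · exact (Nat.pow_le_pow_left (by omega) a).trans (Nat.pow_le_pow_right (by omega) h)

/-- `3 (L + a)^a ≤ (L + a + 2)^(a + 2)`: two more units of the constant absorb a factor `3`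
(hence a doubling and a `+ 1`). [folklore] -/
theorem three_mul_qexp_le (L a : ℕ) : 3 * (L + a) ^ a ≤ (L + (a + 2)) ^ (a + 2) := by
  have h1 : (L + a) ^ a ≤ (L + (a + 2)) ^ a := Nat.pow_le_pow_left (by omega) a
  have h2 : 3 ≤ (L + (a + 2)) ^ 2 :=
    calc 3 ≤ 2 ^ 2 := by norm_num
      _ ≤ (L + (a + 2)) ^ 2 := Nat.pow_le_pow_left (by omega) 2
  calc 3 * (L + a) ^ a ≤ (L + (a + 2)) ^ 2 * (L + (a + 2)) ^ a := Nat.mul_le_mul h2 h1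
    _ = (L + (a + 2)) ^ (a + 2) := by rw [← pow_add, add_comm 2 a]

/-! ### Closure properties -/

/-- Constants are quasi-polynomially bounded. [folklore] -/
protected theorem const (c : ℕ) : IsQPBounded fun _ => c :=
  (IsPBounded.const c).isQPBounded

/-- Domination preserves quasi-polynomial boundedness. [folklore] -/
protected theorem mono {s t : ℕ → ℕ} (ht : IsQPBounded t) (h : ∀ n, s n ≤ t n) :
    IsQPBounded s := by
  obtain ⟨c, hc⟩ := ht
  exact ⟨c, fun n => (h n).trans (hc n)⟩

/-- Quasi-polynomially bounded functions are closed under sums: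
`2^E + 2^E = 2^(E + 1) ≤ 2^((L + c + 2)^(c + 2))`. [folklore] -/
protected theorem add {s t : ℕ → ℕ} (hs : IsQPBounded s) (ht : IsQPBounded t) :
    IsQPBounded fun n => s n + t n := by
  obtain ⟨a, ha⟩ := hs
  obtain ⟨b, hb⟩ := ht
  refine ⟨max a b + 2, fun n => ?_⟩
  have h1 := (ha n).trans
    (Nat.pow_le_pow_right Nat.two_pos (qexp_mono (Nat.log 2 n) (le_max_left a b)))
  have h2 := (hb n).trans
    (Nat.pow_le_pow_right Nat.two_pos (qexp_mono (Nat.log 2 n) (le_max_right a b)))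
  have h3 := three_mul_qexp_le (Nat.log 2 n) (max a b)
  have h4 := one_le_qexp (Nat.log 2 n) (max a b)
  calc s n + t n ≤ 2 ^ ((Nat.log 2 n + max a b) ^ max a b + 1) := by rw [pow_succ]; omega
    _ ≤ 2 ^ ((Nat.log 2 n + (max a b + 2)) ^ (max a b + 2)) :=
        Nat.pow_le_pow_right Nat.two_pos (by omega)

/-- Quasi-polynomially bounded functions are closed under products:
`2^E · 2^E = 2^(2E) ≤ 2^((L + c + 2)^(c + 2))`. [folklore] -/
protected theorem mul {s t : ℕ → ℕ} (hs : IsQPBounded s) (ht : IsQPBounded t) :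
    IsQPBounded fun n => s n * t n := by
  obtain ⟨a, ha⟩ := hs
  obtain ⟨b, hb⟩ := ht
  refine ⟨max a b + 2, fun n => ?_⟩
  have h1 := (ha n).trans
    (Nat.pow_le_pow_right Nat.two_pos (qexp_mono (Nat.log 2 n) (le_max_left a b)))
  have h2 := (hb n).trans
    (Nat.pow_le_pow_right Nat.two_pos (qexp_mono (Nat.log 2 n) (le_max_right a b)))
  have h3 := three_mul_qexp_le (Nat.log 2 n) (max a b)
  calc s n * t n
      ≤ 2 ^ ((Nat.log 2 n + max a b) ^ max a b) * 2 ^ ((Nat.log 2 n + max a b) ^ max a b) :=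
        Nat.mul_le_mul h1 h2
    _ = 2 ^ (2 * (Nat.log 2 n + max a b) ^ max a b) := by rw [← pow_add, two_mul]
    _ ≤ 2 ^ ((Nat.log 2 n + (max a b + 2)) ^ (max a b + 2)) :=
        Nat.pow_le_pow_right Nat.two_pos (by omega)

/-- Quasi-polynomially bounded functions are closed under fixed powers. [folklore] -/
protected theorem pow {t : ℕ → ℕ} (ht : IsQPBounded t) (k : ℕ) : IsQPBounded fun n => t n ^ k := by
  induction k with
  | zero => simpa using IsQPBounded.const 1
  | succ k ih => simpa [pow_succ] using IsQPBounded.mul ih ht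

/-- **qp ∘ poly = qp**: along a p-bounded `t`, `n ↦ 2 ^ ((log₂ (t n) + c) ^ c)` is
quasi-polynomially bounded (`log₂ (t n) ≤ (log₂ n + k)^k` by `IsPBounded.isQPBounded`, then
`((L + K)^K)^c ≤ (L + K c + K)^(K c + K)`). [folklore] -/
theorem two_pow_qexp_log {t : ℕ → ℕ} (ht : IsPBounded t) (c : ℕ) :
    IsQPBounded fun n => 2 ^ ((Nat.log 2 (t n) + c) ^ c) := by
  obtain ⟨k, hk⟩ := ht.isQPBounded
  refine ⟨(max k c + 2) * c + (max k c + 2), fun n => Nat.pow_le_pow_right Nat.two_pos ?_⟩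
  have h1 : Nat.log 2 (t n) ≤ (Nat.log 2 n + k) ^ k :=
    calc Nat.log 2 (t n) ≤ Nat.log 2 (2 ^ ((Nat.log 2 n + k) ^ k)) := Nat.log_mono_right (hk n)
      _ = (Nat.log 2 n + k) ^ k := Nat.log_pow Nat.one_lt_two _
  have h2 : Nat.log 2 (t n) + c ≤ (Nat.log 2 n + (max k c + 2)) ^ (max k c + 2) := by
    have ha := qexp_mono (Nat.log 2 n) (le_max_left k c)
    have hb := (le_qexp (Nat.log 2 n) c).trans (qexp_mono (Nat.log 2 n) (le_max_right k c))
    have h3 := three_mul_qexp_le (Nat.log 2 n) (max k c)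
    omega
  calc (Nat.log 2 (t n) + c) ^ c ≤ ((Nat.log 2 n + (max k c + 2)) ^ (max k c + 2)) ^ c :=
        Nat.pow_le_pow_left h2 c
    _ = (Nat.log 2 n + (max k c + 2)) ^ ((max k c + 2) * c) := by rw [← pow_mul]
    _ ≤ (Nat.log 2 n + ((max k c + 2) * c + (max k c + 2))) ^ ((max k c + 2) * c) :=
        Nat.pow_le_pow_left (by omega) _
    _ ≤ (Nat.log 2 n + ((max k c + 2) * c + (max k c + 2))) ^ ((max k c + 2) * c + (max k c + 2)) :=
        Nat.pow_le_pow_right (by omega) (by omega)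

end IsQPBounded

end Literature.Computability.AlgebraicComplexity
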